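import Mathlib.LinearAlgebra.TensorProduct.Tower
import Mathlib.Algebra.Module.Rat
import Mathlib.Tactic.Module
import Mathlib.Tactic.Linarith
import Mathlib.Tactic.FieldSimp
import HarnessLib

/-!
# Nekovář 1993 §7.14 at a SPLIT multiplicative prime, read on quadratic-twist-rational points:
# the canonical unit part `t(u) = u ⊗ 1 − (ord u / ord q)·(q ⊗ 1)` of a twist-rational Tate
# representative has TRIVIAL NORM, so every norm-composed logarithm kills it — PROVED (kernel line
# for the `(M) ∩ split` height-identification rider, pub-bsdpct referee C R270/R273/R275)

Topic `Literature/NumberTheory/EllipticCurves/Nekovar1993`, namespace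
`Literature.NumberTheory.EllipticCurves.Nekovar1993`. Cell `bsd-addord` (home
`run/shared/lean/pub/bsd-addord/`), seat `bsd-addord-k1-rf` gen 4; audit sheet of record
`HOME/audit/D-AUDIT-hCyc-D17-Rem132-height-id.md` (sha16 e95bd23c0ceca9a1) + ADDENDUM-1
(e34b0a6e5e44b75f) §4 row `(M)∩split`, steps (a)–(c). Theorems only: NO named fact, no
definition, nothing asserted about elliptic curves — this file is the ALGEBRA of the two-line lemma,
stated over an arbitrary abelian group so that its instantiation is a substitution.

## The printed formula and the unprinted two-line lemma

Nekovář, *On p-adic height pairings*, Progr. Math. 108 (1993) 127–202, **7.14** (typescript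
pp. 44–45): for `V = V_p(E)`, `E` an elliptic curve over a number field `K′` with split multiplicative
reduction at the primes `℘ ∈ P_T` (Tate parameter `q_℘`), the norm-adapted height "à la Schneider"
and the canonical height differ by an explicit local term,
`h^{norm}(x,y) = h^{can}(x,y) − Σ_{℘ ∈ P_T} l_℘(t_℘(x)) l_℘(t_℘(y)) / l_℘(q_℘)`, defined iff
`l_℘(q_℘) ≠ 0` for all `℘ ∈ P_T`; here `x_℘ ∈ E(K′_℘) ⊗ ℚ = (K′_℘^× / q_℘^ℤ) ⊗ ℚ`, `t_℘(x) ∈ O_℘^× ⊗ ℚ`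
is its unit representative and `l_℘ : K′_℘^× ⊗ ℚ → ℚ_p` the local component of the global
logarithm `l` attached to the chosen `ℤ_p`-extension (7.12). [cite: Nekovar1993, 7.14 (pp. 44–45)]

THE RIDER (referee C, pub-bsdpct ROUND 270 / 273 / 275, on the reading fact
`Literature.NumberTheory.EllipticCurves.Disegni2017.delbourgoDatum_cycLineGrossZagier[_intrinsicThree]`,
disjunct (M)): in the cell's situation `E/ℚ` has ADDITIVE, potentially multiplicative reduction at
an odd prime `p`, `V = E ⊗ ε` (the twist by the quadratic character `ε` of `K′ = ℚ(√p*)`) is SPLIT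
multiplicative at `p` with Tate parameter `q = q_V ∈ pℤ_p ⊂ ℚ_p^×`, `𝔭 ∣ p` is the (ramified) prime of
`K′`, `τ` generates `Gal(K′_𝔭/ℚ_p)`, and the logarithm of the CYCLOTOMIC `ℤ_p`-extension of `K′` has
local component `l_𝔭 = ℓ_p ∘ N_{K′_𝔭/ℚ_p}`. 7.14 PRINTS the correction formula on `E(K′)`; that the
correction VANISHES on the sub-lattice `E(ℚ) ⊂ E(ℚ_p) ⊂ E(K′_𝔭) = V(K′_𝔭) = K′_𝔭^×/q^ℤ` is the
following two-line lemma (ADDENDUM-1 §4 (a)–(c); "sound but unprinted — derivation-backed until a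
kernel line or printed source lands", R273):

* (a) CANONICAL UNIT PART. For `u ∈ K′_𝔭^×`, `t(u) := u ⊗ 1 − (ord_𝔭 u / ord_𝔭 q)·(q ⊗ 1) ∈ K′_𝔭^× ⊗ ℚ`
  has `(ord_𝔭 ⊗ ℚ)(t(u)) = 0` (so `t(u) ∈ O_𝔭^× ⊗ ℚ`), kills `q^ℤ` (so `t` is defined on
  `K′_𝔭^×/q^ℤ = V(K′_𝔭)`), needs no uniformiser, and is `Gal(K′_𝔭/ℚ_p)`-equivariant
  (`ord_𝔭 ∘ τ = ord_𝔭`, `τ q = q`). This is 7.14's "unit representative `t_℘(x) ∈ O_℘^* ⊗ ℚ`".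
* (b) TWIST-RATIONAL POINTS HAVE NORM-TRIVIAL UNIT PART. `E = V ⊗ ε`, so under Tate's
  (Galois-equivariant, `q ∈ ℚ_p`) uniformisation of `V` over `K′_𝔭` the subgroup `E(ℚ_p) ⊂ V(K′_𝔭)`
  is `{u mod q^ℤ : τ u ≡ u⁻¹ mod q^ℤ}` = `{u : u·τ(u) ∈ q^ℤ}` (Silverman, *ATAEC* Thm. V.5.3 /
  Cor. V.5.4 shape; in the tree for multiplicative places of number fields:
  `Literature.NumberTheory.EllipticCurves.TateCurve.Silverman1994_thmV53_corV54_tateUniformisation_holds`,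
  whose fixed-point clause is literally "`u σ(u) ∈ q^ℤ` for `σ t ≠ t`"). For such `u`,
  `τ t(u) = t(τ u) = −t(u)`, i.e. `N_{K′_𝔭/ℚ_p}(t(u)) = (1 + τ)(t(u)) = 0` in `K′_𝔭^× ⊗ ℚ`
  (multiplicatively: `N(t(u)) = 1`).
* (c) Hence for EVERY additive map `λ` out of `K′_𝔭^×` into a `ℚ`-vector space (e.g. `ℓ_p` on
  `ℚ_p^× ⊇ N(K′_𝔭^×)`, extended anyhow) the norm-composed map `l = λ ∘ N` satisfies
  `l(t(u)) := l(u) − (ord u / ord q)·l(q) = 0`; with `λ = ℓ_p` this is `l_𝔭(t_𝔭(x)) = 0` for every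
  `x ∈ E(ℚ_p)`, so 7.14's correction term vanishes identically on `E(ℚ) × E(ℚ)` and
  `h^{norm}|_{E(ℚ)} = h^{can}|_{E(ℚ)}` on the `(M) ∩ split` rows (derived here from the printed 7.14).

## What is proved here (all abstract; `A` = `K′_𝔭^×` written additively, `ord : A →+ ℤ` = `ord_𝔭`,
## `τ : A →+ A` = the Galois involution, `q` = the Tate parameter, `V` any `ℚ`-module, `λ : A →+ V`)

For an additive map `l : A →+ V` we write the unit part THROUGH `l`, i.e. the element
`l u − ((ord u : ℚ) / ord q) • l q` of `V` (this is `(l ⊗ ℚ)(t(u))`; no definition is introduced).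
* `unitPart_q`, `unitPart_add_zsmul` — (a): `t` kills `q` and is `q^ℤ`-periodic;
* `ord_unitPart` — (a): `(ord ⊗ ℚ)(t(u)) = 0`;
* `unitPart_map_of_ord_comp` — (a): equivariance `t_l(τ u) = t_{l∘τ}(u)` when `ord ∘ τ = ord`, `τ q = q`;
* `two_mul_ord_eq_of_twistRational` — the valuation identity `2·ord u = k·ord q` for
  `u + τ u = k•q`;
* **`norm_comp_unitPart_eq_zero_of_twistRational`** — (b)+(c): for `l = λ ∘ (1 + τ)`,
  `l u − (ord u / ord q) • l q = 0` whenever `u + τ u ∈ ℤ•q`;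
* **`norm_unitPart_tmul_eq_zero_of_twistRational`** — (b) literally in `ℚ ⊗_ℤ A`:
  `(1 + τ_ℚ)(1 ⊗ u − (ord u / ord q) • (1 ⊗ q)) = 0`;
* `Multiplicative` wrappers `…_of_mul_map_eq_zpow` for a commutative GROUP `G` (`= K′_𝔭^×`),
  hypothesis `u * τ u = q ^ k` verbatim as in the tree's twisted uniformisation theorem.

No elliptic curve, local field or height pairing is mentioned in the statements: the dictionary
above is the whole instantiation, and each hypothesis (`ord q ≠ 0`: `q ∈ pℤ_p` non-unit;
`ord ∘ τ = ord`: `τ` is an isometry; `τ q = q`: `q ∈ ℚ_p`; `u·τu ∈ q^ℤ`: twist-rationality) is a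
printed property of the objects of 7.14 in the cell's situation. HONEST LIMITS: this file does not
formalise Nekovář's heights, nor Tate's uniformisation over `K′_𝔭` for the cell's `V`, nor the
identification `l_𝔭 = ℓ_p ∘ N` (7.12, cyclotomic `ℤ_p`-extension) — those are the printed inputs
named in the audit sheet; it checks exactly the unprinted algebra between them.

## References
* [Nekovar1993] J. Nekovář, *On p-adic height pairings*, Sém. Théorie des Nombres Paris 1990–91,
  Progr. Math. 108, Birkhäuser 1993, 127–202; 7.12, Thm. 7.13, 7.14, §8.1 (held:
  `paper:doi-10-1007-978-1-4757-4271-8-8`).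
* [SilvermanATAEC1994] J. H. Silverman, *Advanced Topics in the Arithmetic of Elliptic Curves*,
  GTM 151, Thm. V.5.3, Cor. V.5.4.
* [Disegni2017] D. Disegni, *The p-adic Gross–Zagier formula on Shimura curves*, Compos. Math. 153
  (2017), Rem. 1.3.2 (the reading whose (M)-disjunct carries the rider).
* [Delbourgo2002] D. Delbourgo, *On the p-adic Birch, Swinnerton-Dyer conjecture for non-semistable
  reduction*, J. Number Theory 95 (2002), p. 39 / p. 61 (the `K′`-pairing `[K′:ℚ]⁻¹⟨,⟩^{Sch}_{p,K′}`).
-/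

namespace Literature.NumberTheory.EllipticCurves.Nekovar1993

section Additive

variable {A V : Type*} [AddCommGroup A] [AddCommGroup V] [Module ℚ V]

/-- (a) The unit part kills the Tate parameter: `t_l(q) = l q − (ord q / ord q) • l q = 0`
(`ord q ≠ 0`). [cite: Nekovar1993, 7.14 (pp. 44–45: unit representative t_℘)] -/
theorem unitPart_q (ord : A →+ ℤ) (l : A →+ V) {q : A} (hq : ord q ≠ 0) :
    l q - ((ord q : ℚ) / (ord q : ℚ)) • l q = 0 := by
  rw [div_self (Int.cast_ne_zero.mpr hq), one_smul, sub_self]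

/-- (a) The unit part is `q^ℤ`-periodic, i.e. it is defined on `A / ℤq` (`= K′_𝔭^×/q^ℤ = V(K′_𝔭)`):
`t_l(u + k•q) = t_l(u)`. [cite: Nekovar1993, 7.14 (pp. 44–45: unit representative t_℘)] -/
theorem unitPart_add_zsmul (ord : A →+ ℤ) (l : A →+ V) {q : A} (hq : ord q ≠ 0) (u : A) (k : ℤ) :
    l (u + k • q) - ((ord (u + k • q) : ℚ) / (ord q : ℚ)) • l q =
      l u - ((ord u : ℚ) / (ord q : ℚ)) • l q := by
  have hq' : (ord q : ℚ) ≠ 0 := Int.cast_ne_zero.mpr hq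
  have hc : ((ord (u + k • q) : ℤ) : ℚ) / (ord q : ℚ) = (ord u : ℚ) / (ord q : ℚ) + k := by
    have h1 : ((ord (u + k • q) : ℤ) : ℚ) = ord u + k * ord q := by
      rw [map_add, map_zsmul, smul_eq_mul]; push_cast; ring
    rw [h1, add_div, mul_div_assoc, div_self hq', mul_one]
  rw [hc, map_add, map_zsmul, ← Int.cast_smul_eq_zsmul ℚ k (l q)]
  module

/-- (a) The unit part has valuation zero: `(ord ⊗ ℚ)(t(u)) = ord u − (ord u / ord q)·ord q = 0`, i.e.
`t(u) ∈ O_𝔭^× ⊗ ℚ` — 7.14's "unit representative". [cite: Nekovar1993, 7.14 (pp. 44–45)] -/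
theorem ord_unitPart (ord : A →+ ℤ) {q : A} (hq : ord q ≠ 0) (u : A) :
    (ord u : ℚ) - ((ord u : ℚ) / (ord q : ℚ)) • (ord q : ℚ) = 0 := by
  rw [smul_eq_mul, div_mul_cancel₀ _ (Int.cast_ne_zero.mpr hq), sub_self]

/-- (a) Galois-equivariance of the unit part: if `τ` preserves `ord` and fixes `q` then
`t_l(τ u) = t_{l ∘ τ}(u)` (so `τ t(u) = t(τ u)` in `K′_𝔭^× ⊗ ℚ`).
[cite: Nekovar1993, 7.14 (pp. 44–45)] -/
theorem unitPart_map_of_ord_comp (ord : A →+ ℤ) (τ : A →+ A) (l : A →+ V) {q : A}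
    (hτq : τ q = q) (hord : ∀ x, ord (τ x) = ord x) (u : A) :
    l (τ u) - ((ord (τ u) : ℚ) / (ord q : ℚ)) • l q =
      (l.comp τ) u - ((ord u : ℚ) / (ord q : ℚ)) • (l.comp τ) q := by
  rw [AddMonoidHom.comp_apply, AddMonoidHom.comp_apply, hτq, hord]

/-- The valuation identity behind (b): if `τ` preserves `ord`, fixes `q`, and `u` is twist-rational
(`u + τ u = k • q`, multiplicatively `u·τ(u) = q^k`), then `2·ord u = k·ord q`.
[cite: Nekovar1993, 7.14 (pp. 44–45)] -/
theorem two_mul_ord_eq_of_twistRational (ord : A →+ ℤ) (τ : A →+ A) {q u : A} {k : ℤ}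
    (hord : ∀ x, ord (τ x) = ord x) (hu : u + τ u = k • q) : 2 * ord u = k * ord q := by
  have h := congrArg ord hu
  rw [map_add, hord, map_zsmul, smul_eq_mul] at h
  linarith

/-- **(b)+(c) — the kernel line of the `(M) ∩ split` rider.** Let `τ : A →+ A` preserve `ord` and fix
the Tate parameter `q` (`ord q ≠ 0`), and let `l = λ ∘ (1 + τ)` be any NORM-COMPOSED additive map into
a `ℚ`-vector space (`l_𝔭 = ℓ_p ∘ N_{K′_𝔭/ℚ_p}`). Then for every twist-rational `u`
(`u + τ u = k • q`, i.e. `u·τ(u) ∈ q^ℤ` — the points of `E(ℚ_p) ⊂ V(K′_𝔭) = K′_𝔭^×/q^ℤ`),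
`l` kills the unit part: `l u − (ord u / ord q) • l q = 0`, i.e. `l_𝔭(t_𝔭(x)) = 0`; hence Nekovář's
7.14 correction `l_𝔭(t_𝔭 x) l_𝔭(t_𝔭 y)/l_𝔭(q)` vanishes for `x, y ∈ E(ℚ)`.
[cite: Nekovar1993, 7.14 (pp. 44–45)] -/
theorem norm_comp_unitPart_eq_zero_of_twistRational (ord : A →+ ℤ) (τ : A →+ A) (lam : A →+ V)
    {q u : A} {k : ℤ} (hq : ord q ≠ 0) (hτq : τ q = q) (hord : ∀ x, ord (τ x) = ord x)
    (hu : u + τ u = k • q) :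
    (lam.comp (AddMonoidHom.id A + τ)) u
      - ((ord u : ℚ) / (ord q : ℚ)) • (lam.comp (AddMonoidHom.id A + τ)) q = 0 := by
  have hq' : (ord q : ℚ) ≠ 0 := Int.cast_ne_zero.mpr hq
  have h2 : (2 : ℚ) * ord u = k * ord q := by
    exact_mod_cast two_mul_ord_eq_of_twistRational ord τ hord hu
  have hdiv : (ord u : ℚ) / (ord q : ℚ) = (k : ℚ) / 2 := by
    rw [div_eq_div_iff hq' two_ne_zero]
    linarith
  rw [hdiv, AddMonoidHom.comp_apply, AddMonoidHom.comp_apply, AddMonoidHom.add_apply,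
    AddMonoidHom.add_apply, AddMonoidHom.id_apply, AddMonoidHom.id_apply, hτq, hu, map_zsmul,
    map_add, ← Int.cast_smul_eq_zsmul ℚ k (lam q)]
  module

/-- (b)+(c), membership form: the same with the twist-rationality hypothesis stated as
`u + τ u ∈ ℤ•q` (`u·τ(u) ∈ q^ℤ`). [cite: Nekovar1993, 7.14 (pp. 44–45)] -/
theorem norm_comp_unitPart_eq_zero_of_mem_zmultiples (ord : A →+ ℤ) (τ : A →+ A) (lam : A →+ V)
    {q u : A} (hq : ord q ≠ 0) (hτq : τ q = q) (hord : ∀ x, ord (τ x) = ord x)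
    (hu : u + τ u ∈ AddSubgroup.zmultiples q) :
    (lam.comp (AddMonoidHom.id A + τ)) u
      - ((ord u : ℚ) / (ord q : ℚ)) • (lam.comp (AddMonoidHom.id A + τ)) q = 0 := by
  obtain ⟨k, hk⟩ := AddSubgroup.mem_zmultiples_iff.mp hu
  exact norm_comp_unitPart_eq_zero_of_twistRational ord τ lam hq hτq hord hk.symm

end Additive

/-! ### (b) literally: `N(t(u)) = 0` in `K′_𝔭^× ⊗ ℚ` (here `ℚ ⊗_ℤ A`) -/

section Tensor

open scoped TensorProduct

variable {A : Type*} [AddCommGroup A]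

/-- **(b) in the `ℚ`-vector space `ℚ ⊗_ℤ A` (`= K′_𝔭^× ⊗ ℚ`).** With `t(u) := 1 ⊗ u − (ord u/ord q)•(1 ⊗ q)`
and `τ_ℚ = ℚ ⊗ τ`, a twist-rational `u` (`u + τ u = k•q`) has `t(u) + τ_ℚ(t(u)) = 0`, i.e.
`N_{K′_𝔭/ℚ_p}(t(u)) = 1` multiplicatively. [cite: Nekovar1993, 7.14 (pp. 44–45)] -/
theorem norm_unitPart_tmul_eq_zero_of_twistRational (ord : A →+ ℤ) (τ : A →+ A) {q u : A} {k : ℤ}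
    (hq : ord q ≠ 0) (hτq : τ q = q) (hord : ∀ x, ord (τ x) = ord x) (hu : u + τ u = k • q) :
    ((1 : ℚ) ⊗ₜ[ℤ] u - ((ord u : ℚ) / (ord q : ℚ)) • ((1 : ℚ) ⊗ₜ[ℤ] q))
      + (τ.toIntLinearMap.baseChange ℚ)
          ((1 : ℚ) ⊗ₜ[ℤ] u - ((ord u : ℚ) / (ord q : ℚ)) • ((1 : ℚ) ⊗ₜ[ℤ] q)) = 0 := by
  -- `x ↦ 1 ⊗ x` as an additive map `A →+ ℚ ⊗ A`
  set lam : A →+ ℚ ⊗[ℤ] A := ((TensorProduct.mk ℤ ℚ A) 1).toAddMonoidHom with hlam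
  have key := norm_comp_unitPart_eq_zero_of_twistRational ord τ lam hq hτq hord hu
  have hl : ∀ x : A, (lam.comp (AddMonoidHom.id A + τ)) x = (1 : ℚ) ⊗ₜ[ℤ] x + (1 : ℚ) ⊗ₜ[ℤ] τ x := by
    intro x
    simp [hlam, TensorProduct.tmul_add]
  rw [hl, hl, hτq] at key
  rw [map_sub, map_smul, LinearMap.baseChange_tmul, LinearMap.baseChange_tmul]
  convert key using 1
  simp only [AddMonoidHom.coe_toIntLinearMap, hτq, smul_add]
  abel

end Tensor

/-! ### Multiplicative wrappers (`G = K′_𝔭^×` as a commutative group, `u·τ(u) = q^k`) -/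

section Multiplicative

variable {G V : Type*} [CommGroup G] [AddCommGroup V] [Module ℚ V]

/-- The valuation identity, multiplicatively: `τ` an endomorphism of the commutative group `G`
preserving `ord` and fixing `q`, `u * τ u = q ^ k` ⟹ `2·ord u = k·ord q`.
[cite: Nekovar1993, 7.14 (pp. 44–45)] -/
theorem two_mul_ord_eq_of_mul_map_eq_zpow (ord : Additive G →+ ℤ) (τ : G →* G) {q u : G} {k : ℤ}
    (hord : ∀ x : G, ord (Additive.ofMul (τ x)) = ord (Additive.ofMul x))
    (hu : u * τ u = q ^ k) :
    2 * ord (Additive.ofMul u) = k * ord (Additive.ofMul q) := by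
  refine two_mul_ord_eq_of_twistRational ord (MonoidHom.toAdditive τ) (q := Additive.ofMul q)
    (u := Additive.ofMul u) (fun x ↦ hord (Additive.toMul x)) ?_
  change Additive.ofMul (u * τ u) = Additive.ofMul (q ^ k)
  rw [hu]

/-- **(b)+(c), multiplicatively.** `G` a commutative group (`K′_𝔭^×`), `τ : G →* G` preserving `ord`
with `τ q = q`, `ord q ≠ 0`; `λ : Additive G →+ V` any additive map into a `ℚ`-vector space and
`l := λ ∘ N` with `N u = u * τ u`. If `u * τ u = q ^ k` (twist-rational: the tree's twisted Tate
uniformisation names exactly this condition, `u σ(u) ∈ q^ℤ`), then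
`l u − (ord u / ord q) • l q = 0`. [cite: Nekovar1993, 7.14 (pp. 44–45)] -/
theorem norm_comp_unitPart_eq_zero_of_mul_map_eq_zpow (ord : Additive G →+ ℤ) (τ : G →* G)
    (lam : Additive G →+ V) {q u : G} {k : ℤ} (hq : ord (Additive.ofMul q) ≠ 0) (hτq : τ q = q)
    (hord : ∀ x : G, ord (Additive.ofMul (τ x)) = ord (Additive.ofMul x))
    (hu : u * τ u = q ^ k) :
    lam (Additive.ofMul (u * τ u))
      - ((ord (Additive.ofMul u) : ℚ) / (ord (Additive.ofMul q) : ℚ)) • lam (Additive.ofMul (q * τ q))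
      = 0 := by
  have key := norm_comp_unitPart_eq_zero_of_twistRational ord (MonoidHom.toAdditive τ) lam
    (q := Additive.ofMul q) (u := Additive.ofMul u) (k := k) hq
    (by change Additive.ofMul (τ q) = Additive.ofMul q; rw [hτq])
    (fun x ↦ hord (Additive.toMul x))
    (by change Additive.ofMul (u * τ u) = Additive.ofMul (q ^ k); rw [hu])
  exact key

/-- The membership form: `u * τ u ∈ q^ℤ` (`Subgroup.zpowers q`).
[cite: Nekovar1993, 7.14 (pp. 44–45)] -/
theorem norm_comp_unitPart_eq_zero_of_mul_map_mem_zpowers (ord : Additive G →+ ℤ) (τ : G →* G)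
    (lam : Additive G →+ V) {q u : G} (hq : ord (Additive.ofMul q) ≠ 0) (hτq : τ q = q)
    (hord : ∀ x : G, ord (Additive.ofMul (τ x)) = ord (Additive.ofMul x))
    (hu : u * τ u ∈ Subgroup.zpowers q) :
    lam (Additive.ofMul (u * τ u))
      - ((ord (Additive.ofMul u) : ℚ) / (ord (Additive.ofMul q) : ℚ)) • lam (Additive.ofMul (q * τ q))
      = 0 := by
  obtain ⟨k, hk⟩ := Subgroup.mem_zpowers_iff.mp hu
  exact norm_comp_unitPart_eq_zero_of_mul_map_eq_zpow ord τ lam hq hτq hord hk.symm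

end Multiplicative

end Literature.NumberTheory.EllipticCurves.Nekovar1993
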